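import Summits.MatrixMultiplication.OmegaCensus.STPPVosperCoverStageZ

/-!
# ω-census (abelian STPP census): the RUN law — a cheap certificate that an exact-cover search must fail (kernel)

HONEST FRAMING (pub-omega census; verbatim): lottery ticket; floor = certified bounds/negative ranges.
Census STRUCTURE (seat pub-omega-stpp-1 gen 31, 2026-08-28), family (b2).  The exact-cover search `existsCoverZ p YL ZL blocks [] []`
(`STPPVosperCoverStageZ.lean`) is too expensive for one `decide` when the point lists are interval-like (`ℤ₅₉`, case β: `Z°` is a window of
length `15`, `Y°` two runs of `8` and `7` points; millions of candidate pairs).  THIS FILE proves, purely at list level, that a `true` answer of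
`existsCoverZ` is impossible when a small certificate `(w₀, D, runs)` checks out (`runsCert`): all Z-points lie in the cyclic window
`[w₀, w₀ + D)`; the Y-points are labelled by `runs` (first window containing the point) so that two Y-points with different labels are at cyclic
distance `≥ D` in both directions; and for some label `r` the number of Y-points labelled `r` is NOT of the form `Σ_k m_k c_k` with `m_k ≤ b_k`.
REASON (the run law): in a realised block, `C − x₀ ⊆ Z ⊆ window` for any `x₀ ∈ A` (`a ≥ 1`), so any two points of a translate `C − x` are at
cyclic distance `< D` in one direction, hence carry the same label; the translates (`c_k` points each, `≤ b_k` of them per block) partition the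
Y-points, so every label count is such a sum.  Main results: `runCount_mem_runSums` (the invariant along the recursion of `existsCoverZ`) and
`existsCoverZ_false_of_runsCert`.  UNCONDITIONAL; nothing here is progress on `ω`.

References: A. G. Vosper, J. London Math. Soc. 31 (1956); H. Cohn, R. Kleinberg, B. Szegedy, C. Umans, FOCS 2005 (arXiv:math/0511460), Def. 5.1.
-/

open Finset

namespace Summit.MatrixMultiplication.OmegaCensus.CubeNB

/-! ## Modular arithmetic of residues -/

/-- `(u − v) mod p` for residues `u, v < p`, explicitly. [folklore] -/
theorem modSub_eq {p u v : ℕ} (hu : u < p) (hv : v < p) : (u + p - v) % p = if v ≤ u then u - v else u + p - v := by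
  split_ifs with h
  · rw [show u + p - v = (u - v) + p by omega, Nat.add_mod_right, Nat.mod_eq_of_lt (by omega)]
  · exact Nat.mod_eq_of_lt (by omega)

/-- Difference of two differences with a common subtrahend: `((c′ − x) − (c − x)) mod p = (c′ − c) mod p`. [folklore] -/
theorem modSub_modSub {p c c' x : ℕ} (hc : c < p) (hc' : c' < p) (hx : x < p) :
    ((c' + p - x) % p + p - (c + p - x) % p) % p = (c' + p - c) % p := by
  have h1 : (c + p - x) % p < p := Nat.mod_lt _ (by omega)
  have h2 : (c' + p - x) % p < p := Nat.mod_lt _ (by omega)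
  rw [modSub_eq h2 h1, modSub_eq hc' hx, modSub_eq hc hx, modSub_eq hc' hc]
  split_ifs <;> omega

/-- Two residues in a common cyclic window of length `D` are at cyclic distance `< D` in one direction. [folklore] -/
theorem near_of_window {p w₀ D t t' : ℕ} (hw : w₀ < p) (ht : t < p) (ht' : t' < p)
    (h1 : (t + p - w₀) % p < D) (h2 : (t' + p - w₀) % p < D) : (t' + p - t) % p < D ∨ (t + p - t') % p < D := by
  rw [modSub_eq ht hw] at h1
  rw [modSub_eq ht' hw] at h2
  rw [modSub_eq ht' ht, modSub_eq ht ht']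
  split_ifs at h1 h2 ⊢ <;> omega

/-! ## Run labels -/

/-- The run label of a residue `y`: the index of the first window `(s, ℓ)` of `runs` with `(y − s) mod p < ℓ` (`runs.length` if none). [folklore] -/
def runLab (p : ℕ) (runs : List (ℕ × ℕ)) (y : ℕ) : ℕ := runs.findIdx fun w => decide ((y + p - w.1) % p < w.2)

/-- **The run law for one translate.**  If all Z-points lie in the window `[w₀, w₀ + D)`, Y-points with different labels are far apart (cyclic distance
`≥ D` both ways), and `(c − x₀), (c′ − x₀) mod p` are Z-points, then the Y-points `(c − x), (c′ − x) mod p` carry the same label. [folklore] -/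
theorem runLab_eq_of_window {p w₀ D : ℕ} {YL ZL : List ℕ} {runs : List (ℕ × ℕ)} (hw : w₀ < p)
    (hZw : ∀ t ∈ ZL, (t + p - w₀) % p < D)
    (hsep : ∀ y ∈ YL, ∀ y' ∈ YL, runLab p runs y = runLab p runs y' ∨ (D ≤ (y' + p - y) % p ∧ D ≤ (y + p - y') % p))
    {c c' x x₀ : ℕ} (hc : c < p) (hc' : c' < p) (hx : x < p) (hx₀ : x₀ < p)
    (hy : (c + p - x) % p ∈ YL) (hy' : (c' + p - x) % p ∈ YL) (ht : (c + p - x₀) % p ∈ ZL) (ht' : (c' + p - x₀) % p ∈ ZL) :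
    runLab p runs ((c + p - x) % p) = runLab p runs ((c' + p - x) % p) := by
  rcases hsep _ hy _ hy' with h | ⟨hfar1, hfar2⟩
  · exact h
  exfalso
  have hp : 0 < p := by omega
  have e1 : ((c' + p - x) % p + p - (c + p - x) % p) % p = (c' + p - c) % p := modSub_modSub hc hc' hx
  have e2 : ((c + p - x) % p + p - (c' + p - x) % p) % p = (c + p - c') % p := modSub_modSub hc' hc hx
  have e3 : ((c' + p - x₀) % p + p - (c + p - x₀) % p) % p = (c' + p - c) % p := modSub_modSub hc hc' hx₀
  have e4 : ((c + p - x₀) % p + p - (c' + p - x₀) % p) % p = (c + p - c') % p := modSub_modSub hc' hc hx₀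
  rcases near_of_window hw (Nat.mod_lt _ hp) (Nat.mod_lt _ hp) (hZw _ ht) (hZw _ ht') with h3 | h3
  · rw [e3, ← e1] at h3; omega
  · rw [e4, ← e2] at h3; omega

/-! ## Counting along the recursion of `existsCoverZ` -/

/-- If a `Bool` predicate on the differences `(c − x) mod p` does not depend on `c ∈ C`, the number of differences `C − X` (with multiplicity of the
list `diffList`) satisfying it is `|C| · m`, `m` the number of good `x ∈ X`. [folklore] -/
theorem length_filter_diffList {p : ℕ} {P : ℕ → Bool} {X : List ℕ} {c₀ : ℕ} :
    ∀ (C : List ℕ), (∀ c ∈ C, ∀ x ∈ X, P ((c + p - x) % p) = P ((c₀ + p - x) % p)) →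
      ((diffList p C X).filter P).length = C.length * (X.filter fun x => P ((c₀ + p - x) % p)).length
  | [], _ => by simp [diffList]
  | c :: C, h => by
    have ih := length_filter_diffList C (fun c' hc' => h c' (List.mem_cons_of_mem c hc'))
    rw [diffList] at ih
    have hc := h c List.mem_cons_self
    rw [diffList, List.product_cons, List.map_append, List.filter_append, List.length_append, ih, List.map_map, List.filter_map,
      List.length_map, List.length_cons, List.filter_congr (q := fun x => P ((c₀ + p - x) % p)) (fun x hx => by simpa using hc x hx)]
    ring

/-- Unpacking membership in `blockDiffsZ`: the lists `C, B′, A` behind a candidate. [folklore] -/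
theorem exists_of_mem_blockDiffsZ {p : ℕ} {YL ZL : List ℕ} {a b c : ℕ} {YZ : List ℕ × List ℕ} (h : YZ ∈ blockDiffsZ p YL ZL a b c) :
    ∃ C B' A : List ℕ, C ∈ YL.sublistsLen c ∧ B' ∈ ((candShift p C fun y => decide (y ∈ YL)).filter fun x => x != 0).sublistsLen (b - 1) ∧
      A ∈ (candShift p C fun t => decide (t ∈ ZL)).sublistsLen a ∧ (diffList p C (0 :: B')).Nodup ∧
      YZ = (diffList p C (0 :: B'), diffList p C A) := by
  rw [blockDiffsZ, List.mem_flatMap] at h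
  obtain ⟨C, hC, h⟩ := h
  rw [List.mem_flatMap] at h
  obtain ⟨B', hB', h⟩ := h
  rw [List.mem_filterMap] at h
  obtain ⟨A, hA, h⟩ := h
  refine ⟨C, B', A, hC, hB', hA, ?_⟩
  split_ifs at h with hcond
  · rw [Bool.and_eq_true, Bool.and_eq_true, decide_eq_true_eq] at hcond
    exact ⟨hcond.1.1, (Option.some.inj h).symm⟩

/-- Splitting a count of unused Y-points along a new block's Y-set `Yk ⊆ YL` (duplicate-free, disjoint from the used points). [folklore] -/
theorem length_filter_notMem_split {YL Yk uY : List ℕ} (hYL : YL.Nodup) (hYk : Yk.Nodup) (hsub : ∀ y ∈ Yk, y ∈ YL) (hdisj : ∀ y ∈ Yk, y ∉ uY)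
    (P : ℕ → Bool) :
    (YL.filter fun y => P y && !decide (y ∈ uY)).length =
      (YL.filter fun y => P y && !decide (y ∈ Yk ++ uY)).length + (Yk.filter P).length := by
  have key : ∀ (l : List ℕ) (q : ℕ → Bool), l.Nodup → (l.filter q).length = #(l.toFinset.filter fun y => q y = true) := by
    intro l q hl
    rw [← List.toFinset_card_of_nodup (hl.filter q), List.toFinset_filter]
  rw [key YL _ hYL, key YL _ hYL, key Yk _ hYk]
  set T := YL.toFinset.filter fun y => (P y && !decide (y ∈ uY)) = true with hT
  have h1 : (YL.toFinset.filter fun y => (P y && !decide (y ∈ Yk ++ uY)) = true) = T.filter fun y => y ∉ Yk := by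
    ext y
    simp only [hT, Finset.mem_filter, List.mem_toFinset, Bool.and_eq_true, Bool.not_eq_true', decide_eq_false_iff_not, List.mem_append,
      not_or]
    tauto
  have h2 : (Yk.toFinset.filter fun y => P y = true) = T.filter fun y => y ∈ Yk := by
    ext y
    simp only [hT, Finset.mem_filter, List.mem_toFinset, Bool.and_eq_true, Bool.not_eq_true', decide_eq_false_iff_not]
    constructor
    · rintro ⟨hy, hP⟩; exact ⟨⟨hsub y hy, hP, hdisj y hy⟩, hy⟩
    · rintro ⟨⟨-, hP, -⟩, hy⟩; exact ⟨hy, hP⟩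
  rw [h1, h2, add_comm]
  exact (Finset.card_filter_add_card_filter_not _).symm

/-- The admissible label counts: all `Σ_k m_k · c_k` with `m_k ≤ b_k` over the blocks `(a_k, b_k, c_k)`. [folklore] -/
def runSums : List (ℕ × ℕ × ℕ) → List ℕ
  | [] => [0]
  | (_, b, c) :: rest => (runSums rest).flatMap fun s => (List.range (b + 1)).map fun m => s + m * c

/-- **The run law along the recursion (invariant).**  Under the window / separation hypotheses, if `existsCoverZ p YL ZL blocks uY uZ = true` (blocks with
`a, b ≥ 1`), then for every label `r` the number of Y-points with label `r` not yet used is an admissible count `runSums blocks`. [folklore] -/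
theorem runCount_mem_runSums {p w₀ D : ℕ} {YL ZL : List ℕ} {runs : List (ℕ × ℕ)} (hYL : YL.Nodup) (hw : w₀ < p) (hYp : ∀ y ∈ YL, y < p)
    (hZw : ∀ t ∈ ZL, (t + p - w₀) % p < D)
    (hsep : ∀ y ∈ YL, ∀ y' ∈ YL, runLab p runs y = runLab p runs y' ∨ (D ≤ (y' + p - y) % p ∧ D ≤ (y + p - y') % p)) :
    ∀ (blocks : List (ℕ × ℕ × ℕ)) (uY uZ : List ℕ), (∀ blk ∈ blocks, 1 ≤ blk.1 ∧ 1 ≤ blk.2.1) →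
      existsCoverZ p YL ZL blocks uY uZ = true →
      ∀ r : ℕ, (YL.filter fun y => runLab p runs y == r && !decide (y ∈ uY)).length ∈ runSums blocks := by
  intro blocks
  induction blocks with
  | nil =>
    intro uY uZ _ h r
    rw [existsCoverZ, Bool.and_eq_true, List.all_eq_true] at h
    have hnil : (YL.filter fun y => runLab p runs y == r && !decide (y ∈ uY)) = [] := by
      rw [List.filter_eq_nil_iff]
      intro y hy
      have := h.1 y hy
      rw [decide_eq_true_eq] at this
      simp [this]
    rw [hnil, runSums]
    exact List.mem_singleton.2 rfl
  | cons blk rest ih =>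
    obtain ⟨a, b, c⟩ := blk
    intro uY uZ hpos h r
    have hab : 1 ≤ a ∧ 1 ≤ b := hpos (a, b, c) List.mem_cons_self
    rw [existsCoverZ, List.any_eq_true] at h
    obtain ⟨YZ, hYZ, h⟩ := h
    rw [Bool.and_eq_true, Bool.and_eq_true] at h
    obtain ⟨⟨hY1, -⟩, hrec⟩ := h
    obtain ⟨C, B', A, hC, hB', hA, hnd, rfl⟩ := exists_of_mem_blockDiffsZ hYZ
    have ih' := ih _ _ (fun blk hb => hpos blk (List.mem_cons_of_mem _ hb)) hrec r
    rw [List.mem_sublistsLen] at hC hB' hA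
    have hp : 0 < p := by omega
    have hCY : ∀ c' ∈ C, c' ∈ YL := fun c' hc' => hC.1.subset hc'
    have hBmem : ∀ x ∈ (0 :: B'), x < p ∧ ∀ c' ∈ C, (c' + p - x) % p ∈ YL := by
      intro x hx
      rw [List.mem_cons] at hx
      rcases hx with rfl | hx
      · refine ⟨hp, fun c' hc' => ?_⟩
        rw [Nat.sub_zero, Nat.add_mod_right, Nat.mod_eq_of_lt (hYp c' (hCY c' hc'))]
        exact hCY c' hc'
      · have hx' := hB'.1.subset hx
        rw [List.mem_filter, mem_candShift] at hx'
        refine ⟨hx'.1.1, fun c' hc' => ?_⟩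
        have := hx'.1.2 c' hc'
        rwa [decide_eq_true_eq] at this
    obtain ⟨x₀, hx₀⟩ : ∃ x₀, x₀ ∈ A :=
      List.exists_mem_of_ne_nil A (by intro hA0; rw [hA0, List.length_nil] at hA; omega)
    have hx₀' := hA.1.subset hx₀
    rw [mem_candShift] at hx₀'
    have hZmem : ∀ c' ∈ C, (c' + p - x₀) % p ∈ ZL := fun c' hc' => by
      have := hx₀'.2 c' hc'
      rwa [decide_eq_true_eq] at this
    -- the label is constant along each translate `C − x`
    set c₀ := C.headD 0 with hc₀
    set P : ℕ → Bool := fun y => runLab p runs y == r with hP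
    have hconst : ∀ c' ∈ C, ∀ x ∈ (0 :: B'), P ((c' + p - x) % p) = P ((c₀ + p - x) % p) := by
      intro c' hc' x hx
      have hC0 : c₀ ∈ C := by
        cases hCl : C with
        | nil => rw [hCl] at hc'; simp at hc'
        | cons d l => rw [hc₀, hCl]; exact List.mem_cons_self
      have hlab := runLab_eq_of_window hw hZw hsep (hYp _ (hCY c' hc')) (hYp _ (hCY c₀ hC0)) (hBmem x hx).1 hx₀'.1
        ((hBmem x hx).2 c' hc') ((hBmem x hx).2 c₀ hC0) (hZmem c' hc') (hZmem c₀ hC0)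
      simp only [hP, hlab]
    -- the count
    have hYk_sub : ∀ y ∈ diffList p C (0 :: B'), y ∈ YL := by
      intro y hy
      rw [mem_diffList] at hy
      obtain ⟨c', hc', x, hx, rfl⟩ := hy
      exact (hBmem x hx).2 c' hc'
    have hYk_disj : ∀ y ∈ diffList p C (0 :: B'), y ∉ uY := by
      intro y hy
      rw [List.all_eq_true] at hY1
      have := hY1 y hy
      simpa using this
    have hsplit := length_filter_notMem_split hYL hnd hYk_sub hYk_disj P
    have hcnt := length_filter_diffList (p := p) (P := P) (X := 0 :: B') (c₀ := c₀) C hconst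
    set m := ((0 :: B').filter fun x => P ((c₀ + p - x) % p)).length with hm
    have hmb : m ≤ b := by
      have h1 := List.length_filter_le (fun x => P ((c₀ + p - x) % p)) (0 :: B')
      rw [List.length_cons, hB'.2] at h1
      omega
    rw [runSums, List.mem_flatMap]
    refine ⟨_, ih', ?_⟩
    rw [List.mem_map]
    refine ⟨m, List.mem_range.2 (by omega), ?_⟩
    rw [hsplit, hcnt, hC.2]
    ring

/-! ## The certificate -/

/-- **The run certificate** (`Bool`, cheap): `w₀ < p`; `YL` duplicate-free with values `< p`; every Z-point in the window `[w₀, w₀ + D)`; all blocks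
have `a, b ≥ 1`; Y-points with different labels (w.r.t. `runs`) are at cyclic distance `≥ D` both ways; and some label count is not an admissible
sum `runSums blocks`. [folklore] -/
def runsCert (p : ℕ) (YL ZL : List ℕ) (blocks : List (ℕ × ℕ × ℕ)) (w₀ D : ℕ) (runs : List (ℕ × ℕ)) : Bool :=
  decide (w₀ < p) && decide YL.Nodup && (YL.all fun y => decide (y < p)) && (ZL.all fun t => decide ((t + p - w₀) % p < D)) &&
  (blocks.all fun blk => decide (1 ≤ blk.1) && decide (1 ≤ blk.2.1)) &&
  (YL.all fun y => YL.all fun y' =>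
    (runLab p runs y == runLab p runs y') || (decide (D ≤ (y' + p - y) % p) && decide (D ≤ (y + p - y') % p))) &&
  (List.range (runs.length + 1)).any fun r => !decide ((YL.filter fun y => runLab p runs y == r).length ∈ runSums blocks)

/-- **The run law (kernel, UNCONDITIONAL).**  A valid run certificate forces the exact-cover search to fail:
`runsCert p YL ZL blocks w₀ D runs = true → existsCoverZ p YL ZL blocks [] [] = false`. [folklore] -/
theorem existsCoverZ_false_of_runsCert {p w₀ D : ℕ} {YL ZL : List ℕ} {blocks : List (ℕ × ℕ × ℕ)} {runs : List (ℕ × ℕ)}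
    (h : runsCert p YL ZL blocks w₀ D runs = true) : existsCoverZ p YL ZL blocks [] [] = false := by
  rw [runsCert] at h
  simp only [Bool.and_eq_true, Bool.or_eq_true, decide_eq_true_eq, beq_iff_eq, List.all_eq_true, List.any_eq_true] at h
  obtain ⟨⟨⟨⟨⟨⟨hw, hnd⟩, hYp⟩, hZw⟩, hpos⟩, hsep⟩, r, -, hr⟩ := h
  rw [Bool.eq_false_iff]
  intro hcov
  have key := runCount_mem_runSums hnd hw hYp hZw hsep blocks [] [] hpos hcov r
  have heq : (YL.filter fun y => runLab p runs y == r && !decide (y ∈ ([] : List ℕ))) = YL.filter fun y => runLab p runs y == r :=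
    List.filter_congr fun y _ => by simp
  rw [heq] at key
  revert hr
  simp [key]

end Summit.MatrixMultiplication.OmegaCensus.CubeNB
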